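import Summits.ResolutionOfSingularities.ResolutionOfSingularities.Theorems.EquisingularLiftEquisingularLiftNatNosePackage
import Summits.ResolutionOfSingularities.ResolutionOfSingularities.Theorems.EquisingularLiftEquisingularLiftNatPointResolutionRel
import Literature.AlgebraicGeometry.Resolution.PrincipalizationToResolution
import HarnessLib

/-!
# [OURS · L1 W4.5(b) · EL♮] (5) T-NOSE-THEN-POINTS IN THE HORIZONTAL CURRENCY «an `O`-smooth nose, then point steps ⇒ a
# HorizChainE1 stage with regular reduced strict transform» (res-L1-w45b-lead-2's ask 2026-08-27T08:44:37Z / TARGET-CINOSE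
# 2026-08-27T08:49:13Z, the «horizontal sibling» of `elNatBody_of_noseThenPoints`), any `n`

Crux `EquisingularLiftNat` = stmt-ResolutionOfSingularities-20038 (route EquisingularLift), child EL♮(3) = stmt-…-20148, line
`sections`; helper file `--supports … --as helper` by res-type-051 (g14). HONEST FRAMING: OURS (cell res-hironaka, slot W4.5(b));
NOT a statement of any manuscript; a CONDITIONAL rung exactly as its sibling …NatNoseThenPoints.lean (p513523): hypothesis (a) «an
`O`-SMOOTH lift `C` of the nose with `ι(H) ⊄ V(Λ) ⊆ ι(H)`» is a LIFT-type hypothesis (supplied for linear `Λ` by R1 + the adapter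
`LinearCentre.smooth_kerSubschemeι_comp`, and for smooth complete intersections by res-D-pv-027's T-LIFT-CI), hypothesis (b) «after
the blow-up of `ℙⁿ_k` along `Λ` the strict transform of `H` is resolved by finitely many point blow-ups» is the classical downstairs
input. AI-written, weaker than expert review. No `sorry`; standard axioms.

WHY THIS FILE. The sibling concludes in the ITEM's currency (E1 chains WITHOUT the flatness clause, glued by p500485). The
registered stubs of the skeleton `sections` (T-ISO-0, v6-NONISO «smooth complete-intersection nose then points») live in the
HORIZONTAL currency — the closure of `(ℙⁿ_O, 𝟙, Y)` under blow-ups at centres that are regular, `O`-FLAT, off the generic point of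
`Y` and E1 — which is one line EARLIER in the sibling's proof (the output of res-type-022's `pointResolution_from_horizStage`,
p509452). This file exposes that line:

* `horiz_of_noseThenPoints` — hypotheses of `elNatBody_of_noseThenPoints` VERBATIM; conclusion: for `Y = (ι ≫ Proj φ)(H)` some
  `(P′, σ, S′)` in the HorizChainE1 closure of `(ℙⁿ_O, 𝟙, Y)` (WITH the `Flat` clause) has irreducible special fibre, an ambient
  with good reduction at every point over `𝔪_O`, and regular `V(closure S′)_red` (four conjuncts, for K4′ / T-ISO-2 consumers);
* `horizBody_of_noseThenPoints` — the same with the two conjuncts «closure ∧ regular» only: TARGET-CINOSE's per-`(φ, Y)` body;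
* `pointResolvable_univ_of_isRegular` — ZERO point steps: a regular `Z` is point-resolvable for `(Z, univ)` in the PtChain ∃-form
  (`V(closure univ)_red ≅ Z`, `isIso_lift_vanishingIdeal_closure_univ`) — the downstairs datum of «`Bl_Σ H` regular» specimens;
* `horizOver_of_noseThenPoints_closed` — `ι : H → (projectiveSpace n k).left`, the downstairs centre a CLOSED SET `Σ ⊆ ι(H)`,
  `ι(H) ⊄ Σ`, the nose `C` with `C · 𝒪_{ℙⁿ_k} = vanishingIdeal Σ` along EVERY graded `φ` over `π` (the `hKEY` device of
  `elNatOver_of_oneStep₀`, p505461) — conclusion: TARGET-CINOSE's text after «`Function.Surjective π ∧`» for this `(O, π)`;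
* `horizAt_of_noseThenPoints_closed` — from a LIFT SUPPLY «for every complete characteristic-0 DVR `O` with algebraically closed
  residue field and every surjection `π : O → k` there is an `O`-smooth `C` with `C · 𝒪_{ℙⁿ_k} = vanishingIdeal Σ` along every
  `φ` over `π`» (the shape res-D-pv-027's T-LIFT-CI produces) and the downstairs data: TARGET-CINOSE's CONCLUSION verbatim
  (`∃ O … π, Function.Surjective π ∧ …`), with `O := 𝕎(k)` (`stub_wittRing`).

So an instance of v6-NONISO is «T-LIFT-CI ∘ `horizAt_of_noseThenPoints_closed`», no further plumbing. The INTRINSIC twins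
(hypothesis (b′) on a blow-up of `H` along `Λ · 𝒪_H`, as in …NatNoseThenPointsIntrinsic.lean p514247) are filed separately.

References: …NatNoseThenPoints.lean (p513523), …NatNosePackage.lean (p512238), …NatPointResolutionRel.lean (p509452),
…NatPointResolution.lean (T-ISO-0, `stub_wittRing` packaging); Liu 2002 §8.1/§9.2; res-L1-w45b-lead-2 TARGET-CINOSE 2026-08-27T08:49:13Z.
-/

set_option linter.dupNamespace false -- mandated namespace `Summit.<Summit>.<Problem>` of this single-conjunct summit
set_option linter.overlappingInstances false -- signatures carry `[IsDomain O] [IsDiscreteValuationRing O]`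

noncomputable section

open CategoryTheory CategoryTheory.Limits AlgebraicGeometry TopologicalSpace Topology
open MvPolynomial
open Literature.AlgebraicGeometry.Resolution
open AlgebraicGeometry.Scheme.IdealSheafData
open Summit.ResolutionOfSingularities.ResolutionOfSingularities.Theses.EquisingularLift.Split
open Summit.ResolutionOfSingularities.ResolutionOfSingularities.Cruxes.EquisingularLift.StrataSplit

attribute [local instance] MvPolynomial.gradedAlgebra

namespace Summit.ResolutionOfSingularities.ResolutionOfSingularities.Cruxes.EquisingularLiftNat.Sections

/-! ## The nose out of `ℙⁿ_O`, then point steps — stopped at the horizontal stage -/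

/-- **(5) T-NOSE-THEN-POINTS, horizontal form, four conjuncts** (module docstring for the reading). `O` a complete DVR with
algebraically closed residue field and a surjection `π : O → k`, `ι : H → ℙⁿ_k` a closed immersion of an integral scheme, `φ`
graded inducing `MvPolynomial.map π`, `Y = (ι ≫ Proj φ)(H)`. If (a) `C` is an ideal sheaf on `ℙⁿ_O` with `V(C) → Spec O` SMOOTH,
`ι(H) ⊄ V(Λ)` and `V(Λ) ⊆ ι(H)` for `Λ = C · 𝒪_{ℙⁿ_k}`, and (b) for some blow-up `υ : F₂ → ℙⁿ_k` along `Λ` the strict transform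
`closure υ⁻¹(ι(H) ∖ V(Λ))` is resolved by finitely many blow-ups at non-regular closed points of the successive reduced strict
transforms, then some `(P′, σ, S′)` in the HorizChainE1 closure of `(ℙⁿ_O, 𝟙, Y)` (steps: blow-ups at centres that are regular,
`O`-flat, off the generic point of `Y`, with special-fibre points inside the running set) has irreducible special fibre, good
reduction at every point over the closed point of `Spec O`, and regular `V(closure S′)_red`. [folklore; Liu 2002 §8.1/§9.2] -/
theorem horiz_of_noseThenPoints (O : Type) [CommRing O] [IsDomain O] [IsDiscreteValuationRing O]
    [IsAdicComplete (IsLocalRing.maximalIdeal O) O] [IsAlgClosed (IsLocalRing.ResidueField O)]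
    (k : Type) [Field k] (π : O →+* k) (hπ : Function.Surjective π) (n : ℕ) (H : Scheme.{0})
    (ι : H ⟶ Proj (homogeneousSubmodule (Fin (n + 1)) k)) [IsClosedImmersion ι] [IsIntegral H]
    (φ : homogeneousSubmodule (Fin (n + 1)) O →+*ᵍ homogeneousSubmodule (Fin (n + 1)) k)
    (hφ' : HomogeneousIdeal.irrelevant (homogeneousSubmodule (Fin (n + 1)) k) ≤
      (HomogeneousIdeal.irrelevant (homogeneousSubmodule (Fin (n + 1)) O)).map φ)
    (hφ : ∀ s, φ s = MvPolynomial.map π s)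
    -- (a) THE NOSE: a centre of `ℙⁿ_O` smooth over `O` with `ι(H) ⊄ V(Λ) ⊆ ι(H)`, `Λ = C · 𝒪_{ℙⁿ_k}`
    (C : (Proj (homogeneousSubmodule (Fin (n + 1)) O)).IdealSheafData)
    (hCsm : Smooth (C.subschemeι ≫ Proj.toSpecZero (homogeneousSubmodule (Fin (n + 1)) O) ≫
      Spec.map (CommRingCat.ofHom (algebraMap O (homogeneousSubmodule (Fin (n + 1)) O 0)))))
    (hgen : ¬ (Set.range ι ⊆ ((C.comap (Proj.map φ hφ')).support : Set (Proj (homogeneousSubmodule (Fin (n + 1)) k)))))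
    (hsupp : ((C.comap (Proj.map φ hφ')).support : Set (Proj (homogeneousSubmodule (Fin (n + 1)) k))) ⊆ Set.range ι)
    -- (b) THEN POINTS: after some blow-up of `ℙⁿ_k` along `Λ` the strict transform of `ι(H)` is point-resolvable
    (hdown : ∃ (F₂ : Scheme.{0}) (υ : F₂ ⟶ Proj (homogeneousSubmodule (Fin (n + 1)) k)),
      IsBlowup υ (C.comap (Proj.map φ hφ')) ∧
      ∃ (F' : Scheme.{0}) (ρ' : F' ⟶ F₂) (T' : Set F'),
        (∀ Q : (∀ F₁ : Scheme.{0}, (F₁ ⟶ F₂) → Set F₁ → Prop),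
          Q F₂ (𝟙 F₂) (closure (υ ⁻¹' (Set.range ι \
            ((C.comap (Proj.map φ hφ')).support : Set (Proj (homogeneousSubmodule (Fin (n + 1)) k)))))) →
          (∀ (F₁ F₃ : Scheme.{0}) (ρ : F₁ ⟶ F₂) (T₁ : Set F₁)
            (x : ↥(vanishingIdeal (⟨closure T₁, isClosed_closure⟩ : Closeds F₁)).subscheme) (υ₁ : F₃ ⟶ F₁)
            (hx : IsClosed ({((vanishingIdeal (⟨closure T₁, isClosed_closure⟩ : Closeds F₁)).subschemeι x : F₁)} : Set F₁)),
            Q F₁ ρ T₁ →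
            ¬ IsRegularLocalRing ((vanishingIdeal (⟨closure T₁, isClosed_closure⟩ : Closeds F₁)).subscheme.presheaf.stalk x) →
            IsBlowup υ₁ (vanishingIdeal
              (⟨{((vanishingIdeal (⟨closure T₁, isClosed_closure⟩ : Closeds F₁)).subschemeι x : F₁)}, hx⟩ : Closeds F₁)) →
            Q F₃ (υ₁ ≫ ρ) (closure (υ₁ ⁻¹' (T₁ \
              {((vanishingIdeal (⟨closure T₁, isClosed_closure⟩ : Closeds F₁)).subschemeι x : F₁)})))) →
          Q F' ρ' T') ∧
        Scheme.IsRegular (vanishingIdeal (⟨closure T', isClosed_closure⟩ : Closeds F')).subscheme) :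
    ∀ Y : Set (Proj (homogeneousSubmodule (Fin (n + 1)) O)), Y = Set.range (ι ≫ Proj.map φ hφ') →
    ∃ (P' : Scheme.{0}) (σ : P' ⟶ Proj (homogeneousSubmodule (Fin (n + 1)) O)) (S' : Set P'),
      (∀ Q : (∀ X' : Scheme.{0}, (X' ⟶ Proj (homogeneousSubmodule (Fin (n + 1)) O)) → Set X' → Prop),
        Q (Proj (homogeneousSubmodule (Fin (n + 1)) O)) (𝟙 _) Y →
        (∀ (X' X'' : Scheme.{0}) (σ' : X' ⟶ Proj (homogeneousSubmodule (Fin (n + 1)) O)) (Y' : Set X')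
          (C : X'.IdealSheafData) (τ : X'' ⟶ X'), Q X' σ' Y' → IsBlowup τ C → Scheme.IsRegular C.subscheme →
          Flat (C.subschemeι ≫ σ' ≫ (Proj.toSpecZero (homogeneousSubmodule (Fin (n + 1)) O) ≫
            Spec.map (CommRingCat.ofHom (algebraMap O (homogeneousSubmodule (Fin (n + 1)) O 0))))) →
          σ' '' (C.support : Set X') ⊆ {x | ¬ IsGenericPoint x Y} →
          (C.support : Set X') ∩ (σ' ≫ (Proj.toSpecZero (homogeneousSubmodule (Fin (n + 1)) O) ≫
            Spec.map (CommRingCat.ofHom (algebraMap O (homogeneousSubmodule (Fin (n + 1)) O 0))))) ⁻¹'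
            {IsLocalRing.closedPoint O} ⊆ Y' →
          Q X'' (τ ≫ σ') (closure (τ ⁻¹' (Y' \ (C.support : Set X'))))) → Q P' σ S') ∧
      IsIrreducible ((σ ≫ (Proj.toSpecZero (homogeneousSubmodule (Fin (n + 1)) O) ≫
        Spec.map (CommRingCat.ofHom (algebraMap O (homogeneousSubmodule (Fin (n + 1)) O 0))))) ⁻¹'
        {IsLocalRing.closedPoint O}) ∧
      (∀ w : P', (σ ≫ (Proj.toSpecZero (homogeneousSubmodule (Fin (n + 1)) O) ≫
          Spec.map (CommRingCat.ofHom (algebraMap O (homogeneousSubmodule (Fin (n + 1)) O 0))))) w =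
          IsLocalRing.closedPoint O →
        GoodAt (σ ≫ (Proj.toSpecZero (homogeneousSubmodule (Fin (n + 1)) O) ≫
          Spec.map (CommRingCat.ofHom (algebraMap O (homogeneousSubmodule (Fin (n + 1)) O 0))))) w) ∧
      Scheme.IsRegular (vanishingIdeal (⟨closure S', isClosed_closure⟩ : Closeds P')).subscheme := by
  classical
  set q : (Proj (homogeneousSubmodule (Fin (n + 1)) O)) ⟶ Spec (.of O) := Proj.toSpecZero (homogeneousSubmodule (Fin (n + 1)) O) ≫
    Spec.map (CommRingCat.ofHom (algebraMap O (homogeneousSubmodule (Fin (n + 1)) O 0))) with hqdef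
  intro Y hY
  obtain ⟨F₂, υ, hυ, hres⟩ := hdown
  -- the nose: blow `ℙⁿ_O` up along `C`
  obtain ⟨P₁, τ, hτ⟩ := exists_isBlowup (Proj (homogeneousSubmodule (Fin (n + 1)) O)) C
  obtain ⟨hYcl, hYirr, hYs, hH₁, hirr₁, hgood₁, hF₂, hirrD, ⟨e⟩, -⟩ :=
    nosePackage₀ O k π hπ n H ι φ hφ' hφ C hCsm hgen hsupp P₁ τ hτ F₂ υ hυ Y hY
  haveI := hF₂
  obtain ⟨hsm, hpr⟩ := stub_projectiveAmbientSmoothProper O n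
  let Yc : Closeds (Proj (homogeneousSubmodule (Fin (n + 1)) O)) := ⟨Y, hYcl⟩
  -- then points: T-ISO-0-REL from the stage `(P₁, τ, closure τ⁻¹(Y ∖ V(C)))`, stopped at the horizontal stage
  obtain ⟨X₂, σ₂, S₂, hH₂, hirr₂, hgood₂, hreg₂⟩ := pointResolution_from_horizStage O
    (Proj (homogeneousSubmodule (Fin (n + 1)) O)) q Yc hsm hpr hYs hYirr P₁ τ
    (closure (τ ⁻¹' (Y \ (C.support : Set (Proj (homogeneousSubmodule (Fin (n + 1)) O))))))
    hH₁ hirr₁ (fun w _ => hgood₁ w) F₂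
    (closure (υ ⁻¹' (Set.range ι \ ((C.comap (Proj.map φ hφ')).support : Set (Proj (homogeneousSubmodule (Fin (n + 1)) k))))))
    isClosed_closure hirrD e hres
  exact ⟨X₂, σ₂, S₂, hH₂, hirr₂, hgood₂, hreg₂⟩

/-- **(5) T-NOSE-THEN-POINTS, horizontal form, TARGET-CINOSE's per-`(φ, Y)` body** — the two conjuncts «`(P′, σ, S′)` lies in
the HorizChainE1 closure of `(ℙⁿ_O, 𝟙, Y)`» and «`V(closure S′)_red` is regular» of `horiz_of_noseThenPoints`. [folklore] -/
theorem horizBody_of_noseThenPoints (O : Type) [CommRing O] [IsDomain O] [IsDiscreteValuationRing O]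
    [IsAdicComplete (IsLocalRing.maximalIdeal O) O] [IsAlgClosed (IsLocalRing.ResidueField O)]
    (k : Type) [Field k] (π : O →+* k) (hπ : Function.Surjective π) (n : ℕ) (H : Scheme.{0})
    (ι : H ⟶ Proj (homogeneousSubmodule (Fin (n + 1)) k)) [IsClosedImmersion ι] [IsIntegral H]
    (φ : homogeneousSubmodule (Fin (n + 1)) O →+*ᵍ homogeneousSubmodule (Fin (n + 1)) k)
    (hφ' : HomogeneousIdeal.irrelevant (homogeneousSubmodule (Fin (n + 1)) k) ≤
      (HomogeneousIdeal.irrelevant (homogeneousSubmodule (Fin (n + 1)) O)).map φ)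
    (hφ : ∀ s, φ s = MvPolynomial.map π s)
    (C : (Proj (homogeneousSubmodule (Fin (n + 1)) O)).IdealSheafData)
    (hCsm : Smooth (C.subschemeι ≫ Proj.toSpecZero (homogeneousSubmodule (Fin (n + 1)) O) ≫
      Spec.map (CommRingCat.ofHom (algebraMap O (homogeneousSubmodule (Fin (n + 1)) O 0)))))
    (hgen : ¬ (Set.range ι ⊆ ((C.comap (Proj.map φ hφ')).support : Set (Proj (homogeneousSubmodule (Fin (n + 1)) k)))))
    (hsupp : ((C.comap (Proj.map φ hφ')).support : Set (Proj (homogeneousSubmodule (Fin (n + 1)) k))) ⊆ Set.range ι)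
    (hdown : ∃ (F₂ : Scheme.{0}) (υ : F₂ ⟶ Proj (homogeneousSubmodule (Fin (n + 1)) k)),
      IsBlowup υ (C.comap (Proj.map φ hφ')) ∧
      ∃ (F' : Scheme.{0}) (ρ' : F' ⟶ F₂) (T' : Set F'),
        (∀ Q : (∀ F₁ : Scheme.{0}, (F₁ ⟶ F₂) → Set F₁ → Prop),
          Q F₂ (𝟙 F₂) (closure (υ ⁻¹' (Set.range ι \
            ((C.comap (Proj.map φ hφ')).support : Set (Proj (homogeneousSubmodule (Fin (n + 1)) k)))))) →
          (∀ (F₁ F₃ : Scheme.{0}) (ρ : F₁ ⟶ F₂) (T₁ : Set F₁)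
            (x : ↥(vanishingIdeal (⟨closure T₁, isClosed_closure⟩ : Closeds F₁)).subscheme) (υ₁ : F₃ ⟶ F₁)
            (hx : IsClosed ({((vanishingIdeal (⟨closure T₁, isClosed_closure⟩ : Closeds F₁)).subschemeι x : F₁)} : Set F₁)),
            Q F₁ ρ T₁ →
            ¬ IsRegularLocalRing ((vanishingIdeal (⟨closure T₁, isClosed_closure⟩ : Closeds F₁)).subscheme.presheaf.stalk x) →
            IsBlowup υ₁ (vanishingIdeal
              (⟨{((vanishingIdeal (⟨closure T₁, isClosed_closure⟩ : Closeds F₁)).subschemeι x : F₁)}, hx⟩ : Closeds F₁)) →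
            Q F₃ (υ₁ ≫ ρ) (closure (υ₁ ⁻¹' (T₁ \
              {((vanishingIdeal (⟨closure T₁, isClosed_closure⟩ : Closeds F₁)).subschemeι x : F₁)})))) →
          Q F' ρ' T') ∧
        Scheme.IsRegular (vanishingIdeal (⟨closure T', isClosed_closure⟩ : Closeds F')).subscheme) :
    ∀ Y : Set (Proj (homogeneousSubmodule (Fin (n + 1)) O)), Y = Set.range (ι ≫ Proj.map φ hφ') →
    ∃ (P' : Scheme.{0}) (σ : P' ⟶ Proj (homogeneousSubmodule (Fin (n + 1)) O)) (S' : Set P'),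
      (∀ Q : (∀ X' : Scheme.{0}, (X' ⟶ Proj (homogeneousSubmodule (Fin (n + 1)) O)) → Set X' → Prop),
        Q (Proj (homogeneousSubmodule (Fin (n + 1)) O)) (𝟙 _) Y →
        (∀ (X' X'' : Scheme.{0}) (σ' : X' ⟶ Proj (homogeneousSubmodule (Fin (n + 1)) O)) (Y' : Set X')
          (C : X'.IdealSheafData) (τ : X'' ⟶ X'), Q X' σ' Y' → IsBlowup τ C → Scheme.IsRegular C.subscheme →
          Flat (C.subschemeι ≫ σ' ≫ (Proj.toSpecZero (homogeneousSubmodule (Fin (n + 1)) O) ≫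
            Spec.map (CommRingCat.ofHom (algebraMap O (homogeneousSubmodule (Fin (n + 1)) O 0))))) →
          σ' '' (C.support : Set X') ⊆ {x | ¬ IsGenericPoint x Y} →
          (C.support : Set X') ∩ (σ' ≫ (Proj.toSpecZero (homogeneousSubmodule (Fin (n + 1)) O) ≫
            Spec.map (CommRingCat.ofHom (algebraMap O (homogeneousSubmodule (Fin (n + 1)) O 0))))) ⁻¹'
            {IsLocalRing.closedPoint O} ⊆ Y' →
          Q X'' (τ ≫ σ') (closure (τ ⁻¹' (Y' \ (C.support : Set X'))))) → Q P' σ S') ∧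
      Scheme.IsRegular (vanishingIdeal (⟨closure S', isClosed_closure⟩ : Closeds P')).subscheme := by
  intro Y hY
  obtain ⟨P', σ, S', hH, -, -, hreg⟩ :=
    horiz_of_noseThenPoints O k π hπ n H ι φ hφ' hφ C hCsm hgen hsupp hdown Y hY
  exact ⟨P', σ, S', hH, hreg⟩

/-! ## Zero point steps: a regular scheme is point-resolvable -/

/-- **`V(closure univ)_red ≅ Z` for a reduced `Z`**: the reduced closed subscheme of `Z` on the closure of `univ` is all of `Z`
(its ideal sheaf is the nilradical, which vanishes), so the canonical lift `Z → V(closure univ)_red` of `𝟙 Z` is an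
isomorphism. [folklore] -/
theorem isIso_lift_vanishingIdeal_closure_univ (Z : Scheme.{0}) [IsReduced Z] :
    ∃ (e : Z ⟶ (vanishingIdeal (⟨closure (Set.univ : Set Z), isClosed_closure⟩ : Closeds Z)).subscheme), IsIso e := by
  let TZ : Closeds Z := ⟨closure (Set.univ : Set Z), isClosed_closure⟩
  have hZker : vanishingIdeal TZ = (𝟙 Z : Z ⟶ Z).ker := by
    rw [← Scheme.IdealSheafData.map_bot, ← Scheme.nilradical_eq_bot, ← Scheme.IdealSheafData.vanishingIdeal_top,
      Scheme.IdealSheafData.map_vanishingIdeal]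
    congr 1
    ext1
    change closure (Set.univ : Set Z) = closure ((𝟙 Z : Z ⟶ Z) '' Set.univ)
    rw [Set.image_univ]
    congr 1
    ext z
    simp
  have hkerZ : (vanishingIdeal TZ).subschemeι.ker = (𝟙 Z : Z ⟶ Z).ker := by
    rw [Scheme.IdealSheafData.ker_subschemeι, hZker]
  exact ⟨IsClosedImmersion.lift _ (𝟙 Z) hkerZ.le, IsClosedImmersion.isIso_lift _ (𝟙 Z) hkerZ⟩

/-- **ZERO POINT STEPS.** A REGULAR scheme `Z` is point-resolvable for the pair `(Z, univ)` in the PtChain ∃-form of T-ISO-0: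
take `(F′, ρ′, T′) = (Z, 𝟙, univ)` (the base of the closure) — `V(closure univ)_red ≅ Z` is regular. This is the downstairs
datum of res-D-pv-027's (L2) «`Bl_Σ H` regular». [folklore] -/
theorem pointResolvable_univ_of_isRegular (Z : Scheme.{0}) (hZ : Scheme.IsRegular Z) :
    ∃ (F' : Scheme.{0}) (ρ' : F' ⟶ Z) (T' : Set F'),
      (∀ Q : (∀ F₁ : Scheme.{0}, (F₁ ⟶ Z) → Set F₁ → Prop), Q Z (𝟙 Z) Set.univ →
        (∀ (F₁ F₃ : Scheme.{0}) (ρ₁ : F₁ ⟶ Z) (T₁ : Set F₁)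
          (x : ↥(vanishingIdeal (⟨closure T₁, isClosed_closure⟩ : Closeds F₁)).subscheme) (υ₁ : F₃ ⟶ F₁)
          (hx : IsClosed ({((vanishingIdeal (⟨closure T₁, isClosed_closure⟩ : Closeds F₁)).subschemeι x : F₁)} : Set F₁)),
          Q F₁ ρ₁ T₁ →
          ¬ IsRegularLocalRing ((vanishingIdeal (⟨closure T₁, isClosed_closure⟩ : Closeds F₁)).subscheme.presheaf.stalk x) →
          IsBlowup υ₁ (vanishingIdeal
            (⟨{((vanishingIdeal (⟨closure T₁, isClosed_closure⟩ : Closeds F₁)).subschemeι x : F₁)}, hx⟩ : Closeds F₁)) →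
          Q F₃ (υ₁ ≫ ρ₁) (closure (υ₁ ⁻¹' (T₁ \
            {((vanishingIdeal (⟨closure T₁, isClosed_closure⟩ : Closeds F₁)).subschemeι x : F₁)})))) →
        Q F' ρ' T') ∧
      Scheme.IsRegular (vanishingIdeal (⟨closure T', isClosed_closure⟩ : Closeds F')).subscheme := by
  haveI : IsReduced Z := hZ.isReduced
  obtain ⟨e, he⟩ := isIso_lift_vanishingIdeal_closure_univ Z
  exact ⟨Z, 𝟙 Z, Set.univ, fun Q h0 _ => h0, hZ.of_iso e⟩

/-! ## Packaging for a CLOSED SET `Σ ⊆ ℙⁿ_k` as the downstairs centre (`Λ := vanishingIdeal Σ`) -/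

/-- **(5) T-NOSE-THEN-POINTS, horizontal form, OVER A FIXED LIFT RING `(O, π)`, downstairs centre a closed set `Σ`.** For an
integral `H` with a closed immersion `ι : H → ℙⁿ_k`, a complete DVR `O` with algebraically closed residue field and a surjection
`π : O → k`, a closed set `Σ ⊆ ι(H)` with `ι(H) ⊄ Σ`, an `O`-SMOOTH centre `C` of `ℙⁿ_O` with `C · 𝒪_{ℙⁿ_k} = vanishingIdeal Σ`
along EVERY graded `φ` inducing `MvPolynomial.map π`, and a point-only resolution of the strict transform `closure υ⁻¹(ι(H) ∖ Σ)`
after some blow-up `υ` of `ℙⁿ_k` along `vanishingIdeal Σ`: for every such `φ` and `Y = (ι ≫ Proj φ)(H)` some `(P′, σ, S′)` in the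
HorizChainE1 closure of `(ℙⁿ_O, 𝟙, Y)` has regular `V(closure S′)_red` — TARGET-CINOSE's conclusion after «`Function.Surjective π ∧`».
[folklore] -/
theorem horizOver_of_noseThenPoints_closed (k : Type) [Field k] (n : ℕ) (H : Scheme.{0})
    (ι : H ⟶ (Literature.AlgebraicGeometry.Motives.projectiveSpace n k).left) [IsClosedImmersion ι] [IsIntegral H]
    (O : Type) [CommRing O] [IsDomain O] [IsDiscreteValuationRing O]
    [IsAdicComplete (IsLocalRing.maximalIdeal O) O] [IsAlgClosed (IsLocalRing.ResidueField O)]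
    (π : O →+* k) (hπ : Function.Surjective π)
    -- the downstairs centre: a closed SET `Σ ⊆ ι(H)`, `ι(H) ⊄ Σ`
    (Sig : Set (Literature.AlgebraicGeometry.Motives.projectiveSpace n k).left) (hSig : IsClosed Sig)
    (hsupp : Sig ⊆ Set.range ι) (hgen : ¬ (Set.range ι ⊆ Sig))
    -- (a) THE NOSE: an `O`-smooth centre of `ℙⁿ_O` with trace the reduced `Σ` along every graded `φ` over `π`
    (C : (Proj (homogeneousSubmodule (Fin (n + 1)) O)).IdealSheafData)
    (hCsm : Smooth (C.subschemeι ≫ Proj.toSpecZero (homogeneousSubmodule (Fin (n + 1)) O) ≫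
      Spec.map (CommRingCat.ofHom (algebraMap O (homogeneousSubmodule (Fin (n + 1)) O 0)))))
    (hKEY : ∀ (φ : homogeneousSubmodule (Fin (n + 1)) O →+*ᵍ homogeneousSubmodule (Fin (n + 1)) k)
      (hφ' : HomogeneousIdeal.irrelevant (homogeneousSubmodule (Fin (n + 1)) k) ≤
        (HomogeneousIdeal.irrelevant (homogeneousSubmodule (Fin (n + 1)) O)).map φ),
      (∀ s, φ s = MvPolynomial.map π s) →
        C.comap (Proj.map φ hφ') = vanishingIdeal (⟨Sig, hSig⟩ : Closeds (Literature.AlgebraicGeometry.Motives.projectiveSpace n k).left))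
    -- (b) THEN POINTS: after some blow-up of `ℙⁿ_k` along `vanishingIdeal Σ` the strict transform of `ι(H)` is point-resolvable
    (hdown : ∃ (F₂ : Scheme.{0}) (υ : F₂ ⟶ (Literature.AlgebraicGeometry.Motives.projectiveSpace n k).left),
      IsBlowup υ (vanishingIdeal (⟨Sig, hSig⟩ : Closeds (Literature.AlgebraicGeometry.Motives.projectiveSpace n k).left)) ∧
      ∃ (F' : Scheme.{0}) (ρ' : F' ⟶ F₂) (T' : Set F'),
        (∀ Q : (∀ F₁ : Scheme.{0}, (F₁ ⟶ F₂) → Set F₁ → Prop),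
          Q F₂ (𝟙 F₂) (closure (υ ⁻¹' (Set.range ι \ Sig))) →
          (∀ (F₁ F₃ : Scheme.{0}) (ρ : F₁ ⟶ F₂) (T₁ : Set F₁)
            (x : ↥(vanishingIdeal (⟨closure T₁, isClosed_closure⟩ : Closeds F₁)).subscheme) (υ₁ : F₃ ⟶ F₁)
            (hx : IsClosed ({((vanishingIdeal (⟨closure T₁, isClosed_closure⟩ : Closeds F₁)).subschemeι x : F₁)} : Set F₁)),
            Q F₁ ρ T₁ →
            ¬ IsRegularLocalRing ((vanishingIdeal (⟨closure T₁, isClosed_closure⟩ : Closeds F₁)).subscheme.presheaf.stalk x) →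
            IsBlowup υ₁ (vanishingIdeal
              (⟨{((vanishingIdeal (⟨closure T₁, isClosed_closure⟩ : Closeds F₁)).subschemeι x : F₁)}, hx⟩ : Closeds F₁)) →
            Q F₃ (υ₁ ≫ ρ) (closure (υ₁ ⁻¹' (T₁ \
              {((vanishingIdeal (⟨closure T₁, isClosed_closure⟩ : Closeds F₁)).subschemeι x : F₁)})))) →
          Q F' ρ' T') ∧
        Scheme.IsRegular (vanishingIdeal (⟨closure T', isClosed_closure⟩ : Closeds F')).subscheme) :
    ∀ (φ : homogeneousSubmodule (Fin (n + 1)) O →+*ᵍ homogeneousSubmodule (Fin (n + 1)) k)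
      (hφ' : HomogeneousIdeal.irrelevant (homogeneousSubmodule (Fin (n + 1)) k) ≤
        (HomogeneousIdeal.irrelevant (homogeneousSubmodule (Fin (n + 1)) O)).map φ),
      (∀ s, φ s = MvPolynomial.map π s) →
    ∀ Y : Set (Proj (homogeneousSubmodule (Fin (n + 1)) O)), Y = Set.range (ι ≫ Proj.map φ hφ') →
    ∃ (P' : Scheme.{0}) (σ : P' ⟶ Proj (homogeneousSubmodule (Fin (n + 1)) O)) (S' : Set P'),
      (∀ Q : (∀ X' : Scheme.{0}, (X' ⟶ Proj (homogeneousSubmodule (Fin (n + 1)) O)) → Set X' → Prop),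
        Q (Proj (homogeneousSubmodule (Fin (n + 1)) O)) (𝟙 _) Y →
        (∀ (X' X'' : Scheme.{0}) (σ' : X' ⟶ Proj (homogeneousSubmodule (Fin (n + 1)) O)) (Y' : Set X')
          (C : X'.IdealSheafData) (τ : X'' ⟶ X'), Q X' σ' Y' → IsBlowup τ C → Scheme.IsRegular C.subscheme →
          Flat (C.subschemeι ≫ σ' ≫ (Proj.toSpecZero (homogeneousSubmodule (Fin (n + 1)) O) ≫
            Spec.map (CommRingCat.ofHom (algebraMap O (homogeneousSubmodule (Fin (n + 1)) O 0))))) →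
          σ' '' (C.support : Set X') ⊆ {x | ¬ IsGenericPoint x Y} →
          (C.support : Set X') ∩ (σ' ≫ (Proj.toSpecZero (homogeneousSubmodule (Fin (n + 1)) O) ≫
            Spec.map (CommRingCat.ofHom (algebraMap O (homogeneousSubmodule (Fin (n + 1)) O 0))))) ⁻¹'
            {IsLocalRing.closedPoint O} ⊆ Y' →
          Q X'' (τ ≫ σ') (closure (τ ⁻¹' (Y' \ (C.support : Set X'))))) → Q P' σ S') ∧
      Scheme.IsRegular (vanishingIdeal (⟨closure S', isClosed_closure⟩ : Closeds P')).subscheme := by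
  intro φ hφ' hφ Y hY
  let ι' : H ⟶ Proj (homogeneousSubmodule (Fin (n + 1)) k) := ι
  haveI : IsClosedImmersion ι' := ‹IsClosedImmersion ι›
  have hK := hKEY φ hφ' hφ
  have hS : ((C.comap (Proj.map φ hφ')).support : Set (Proj (homogeneousSubmodule (Fin (n + 1)) k))) = Sig := by
    rw [hK]
    exact Scheme.IdealSheafData.coe_support_vanishingIdeal
      (X := (Literature.AlgebraicGeometry.Motives.projectiveSpace n k).left) ⟨Sig, hSig⟩
  refine horizBody_of_noseThenPoints O k π hπ n H ι' φ hφ' hφ C hCsm (by rw [hS]; exact hgen) (by rw [hS]; exact hsupp)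
    ?_ Y hY
  rw [hS, hK]
  exact hdown

/-- **(5) T-NOSE-THEN-POINTS, horizontal form, FROM A LIFT SUPPLY — TARGET-CINOSE's conclusion verbatim.** For a prime `p`, an
algebraically closed field `k` of characteristic `p`, an integral `H` with a closed immersion `ι : H → ℙⁿ_k`, a closed set `Σ ⊆ ι(H)`
with `ι(H) ⊄ Σ`: IF for every complete characteristic-`0` DVR `O` with algebraically closed residue field and every surjection
`π : O → k` there is an `O`-SMOOTH centre `C` of `ℙⁿ_O` with `C · 𝒪_{ℙⁿ_k} = vanishingIdeal Σ` along every graded `φ` inducing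
`MvPolynomial.map π` (a LIFT SUPPLY — e.g. res-D-pv-027's T-LIFT-CI for smooth complete intersections, R1 for linear subspaces),
AND after some blow-up of `ℙⁿ_k` along `vanishingIdeal Σ` the strict transform of `ι(H)` is point-resolvable, THEN there are such an
`(O, π)` (namely `O = 𝕎(k)`, `stub_wittRing`) and, for every `φ` over `π` and `Y = (ι ≫ Proj φ)(H)`, some `(P′, σ, S′)` in the
HorizChainE1 closure of `(ℙⁿ_O, 𝟙, Y)` with regular `V(closure S′)_red`. [folklore; Serre 1979 II §5–6 for `𝕎(k)`] -/
theorem horizAt_of_noseThenPoints_closed {p : ℕ} (hp : p.Prime) (k : Type) [Field k] [CharP k p] [IsAlgClosed k] (n : ℕ)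
    (H : Scheme.{0}) (ι : H ⟶ (Literature.AlgebraicGeometry.Motives.projectiveSpace n k).left) [IsClosedImmersion ι]
    [IsIntegral H]
    (Sig : Set (Literature.AlgebraicGeometry.Motives.projectiveSpace n k).left) (hSig : IsClosed Sig)
    (hsupp : Sig ⊆ Set.range ι) (hgen : ¬ (Set.range ι ⊆ Sig))
    -- (a) THE LIFT SUPPLY for the reduced `Σ`
    (hlift : ∀ (O : Type) [CommRing O] [IsDomain O] [IsDiscreteValuationRing O] [CharZero O]
      [IsAdicComplete (IsLocalRing.maximalIdeal O) O] [IsAlgClosed (IsLocalRing.ResidueField O)] (π : O →+* k),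
      Function.Surjective π →
      ∃ C : (Proj (homogeneousSubmodule (Fin (n + 1)) O)).IdealSheafData,
        Smooth (C.subschemeι ≫ Proj.toSpecZero (homogeneousSubmodule (Fin (n + 1)) O) ≫
          Spec.map (CommRingCat.ofHom (algebraMap O (homogeneousSubmodule (Fin (n + 1)) O 0)))) ∧
        ∀ (φ : homogeneousSubmodule (Fin (n + 1)) O →+*ᵍ homogeneousSubmodule (Fin (n + 1)) k)
          (hφ' : HomogeneousIdeal.irrelevant (homogeneousSubmodule (Fin (n + 1)) k) ≤
            (HomogeneousIdeal.irrelevant (homogeneousSubmodule (Fin (n + 1)) O)).map φ),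
          (∀ s, φ s = MvPolynomial.map π s) →
            C.comap (Proj.map φ hφ') =
              vanishingIdeal (⟨Sig, hSig⟩ : Closeds (Literature.AlgebraicGeometry.Motives.projectiveSpace n k).left))
    -- (b) THEN POINTS
    (hdown : ∃ (F₂ : Scheme.{0}) (υ : F₂ ⟶ (Literature.AlgebraicGeometry.Motives.projectiveSpace n k).left),
      IsBlowup υ (vanishingIdeal (⟨Sig, hSig⟩ : Closeds (Literature.AlgebraicGeometry.Motives.projectiveSpace n k).left)) ∧
      ∃ (F' : Scheme.{0}) (ρ' : F' ⟶ F₂) (T' : Set F'),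
        (∀ Q : (∀ F₁ : Scheme.{0}, (F₁ ⟶ F₂) → Set F₁ → Prop),
          Q F₂ (𝟙 F₂) (closure (υ ⁻¹' (Set.range ι \ Sig))) →
          (∀ (F₁ F₃ : Scheme.{0}) (ρ : F₁ ⟶ F₂) (T₁ : Set F₁)
            (x : ↥(vanishingIdeal (⟨closure T₁, isClosed_closure⟩ : Closeds F₁)).subscheme) (υ₁ : F₃ ⟶ F₁)
            (hx : IsClosed ({((vanishingIdeal (⟨closure T₁, isClosed_closure⟩ : Closeds F₁)).subschemeι x : F₁)} : Set F₁)),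
            Q F₁ ρ T₁ →
            ¬ IsRegularLocalRing ((vanishingIdeal (⟨closure T₁, isClosed_closure⟩ : Closeds F₁)).subscheme.presheaf.stalk x) →
            IsBlowup υ₁ (vanishingIdeal
              (⟨{((vanishingIdeal (⟨closure T₁, isClosed_closure⟩ : Closeds F₁)).subschemeι x : F₁)}, hx⟩ : Closeds F₁)) →
            Q F₃ (υ₁ ≫ ρ) (closure (υ₁ ⁻¹' (T₁ \
              {((vanishingIdeal (⟨closure T₁, isClosed_closure⟩ : Closeds F₁)).subschemeι x : F₁)})))) →
          Q F' ρ' T') ∧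
        Scheme.IsRegular (vanishingIdeal (⟨closure T', isClosed_closure⟩ : Closeds F')).subscheme) :
    ∃ (O : Type) (_ : CommRing O) (_ : IsDomain O) (_ : IsDiscreteValuationRing O) (_ : CharZero O) (π : O →+* k),
      Function.Surjective π ∧
      ∀ (φ : homogeneousSubmodule (Fin (n + 1)) O →+*ᵍ homogeneousSubmodule (Fin (n + 1)) k)
        (hφ' : HomogeneousIdeal.irrelevant (homogeneousSubmodule (Fin (n + 1)) k) ≤
          (HomogeneousIdeal.irrelevant (homogeneousSubmodule (Fin (n + 1)) O)).map φ),
        (∀ s, φ s = MvPolynomial.map π s) →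
      ∀ Y : Set (Proj (homogeneousSubmodule (Fin (n + 1)) O)), Y = Set.range (ι ≫ Proj.map φ hφ') →
      ∃ (P' : Scheme.{0}) (σ : P' ⟶ Proj (homogeneousSubmodule (Fin (n + 1)) O)) (S' : Set P'),
        (∀ Q : (∀ X' : Scheme.{0}, (X' ⟶ Proj (homogeneousSubmodule (Fin (n + 1)) O)) → Set X' → Prop),
          Q (Proj (homogeneousSubmodule (Fin (n + 1)) O)) (𝟙 _) Y →
          (∀ (X' X'' : Scheme.{0}) (σ' : X' ⟶ Proj (homogeneousSubmodule (Fin (n + 1)) O)) (Y' : Set X')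
            (C : X'.IdealSheafData) (τ : X'' ⟶ X'), Q X' σ' Y' → IsBlowup τ C → Scheme.IsRegular C.subscheme →
            Flat (C.subschemeι ≫ σ' ≫ (Proj.toSpecZero (homogeneousSubmodule (Fin (n + 1)) O) ≫
              Spec.map (CommRingCat.ofHom (algebraMap O (homogeneousSubmodule (Fin (n + 1)) O 0))))) →
            σ' '' (C.support : Set X') ⊆ {x | ¬ IsGenericPoint x Y} →
            (C.support : Set X') ∩ (σ' ≫ (Proj.toSpecZero (homogeneousSubmodule (Fin (n + 1)) O) ≫
              Spec.map (CommRingCat.ofHom (algebraMap O (homogeneousSubmodule (Fin (n + 1)) O 0))))) ⁻¹'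
              {IsLocalRing.closedPoint O} ⊆ Y' →
            Q X'' (τ ≫ σ') (closure (τ ⁻¹' (Y' \ (C.support : Set X'))))) → Q P' σ S') ∧
        Scheme.IsRegular (vanishingIdeal (⟨closure S', isClosed_closure⟩ : Closeds P')).subscheme := by
  obtain ⟨O, i1, i2, i3, i4, i5, i6, π, hπ⟩ := stub_wittRing p hp k
  obtain ⟨C, hCsm, hKEY⟩ := hlift O π hπ
  exact ⟨O, i1, i2, i3, i4, π, hπ, horizOver_of_noseThenPoints_closed k n H ι O π hπ Sig hSig hsupp hgen C hCsm hKEY hdown⟩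

end Summit.ResolutionOfSingularities.ResolutionOfSingularities.Cruxes.EquisingularLiftNat.Sections

end
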